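import Summits.HodgeConjecture.CorCM.TwoGroupQuaternionSubgroupIndexTwo
import Summits.HodgeConjecture.CorCM.TwoGroupQuaternionRelations
import Mathlib.GroupTheory.Sylow
import HarnessLib

/-!
# A finite `2`-group with a UNIQUE INVOLUTION is cyclic or generalised quaternion

COR-CM (cell `pub-hodgecm2`), binder seat b04 (gen 34), count-neutral own lane «Galois-CM-type classification».  KERNEL ONLY,
Mathlib only (plus the three gen-34 feeders): theorems; no definition, no named fact, no `sorry`.  The classical theorem
[Rotman1995, Thm. 5.46] for `p = 2`, by strong induction on `n` (`|G| = 2^n`) over a subgroup `H` of index two (Sylow): by the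
induction hypothesis `H` is cyclic — then `CorCM/TwoGroupCyclicIndexTwoUniqueInvolution` (gen 34) gives «cyclic or the quaternion
relations» — or of generalised quaternion type, and then `CorCM/TwoGroupQuaternionSubgroupIndexTwo` (gen 34) produces a cyclic
subgroup of index two anyway (or `G` cyclic).  The relations are turned into an isomorphism with Mathlib's `QuaternionGroup` by
`CorCM/TwoGroupQuaternionRelations`.  Consumer: `CorCM/GaloisMinimalTwoPowerClassification` (gen 34): in a GOOD Galois CM field
of `2`-power degree `≥ 64` all involutions of the Galois group are central (gen 32/33), so if moreover complex conjugation is the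
ONLY central involution (no proper Galois CM subfield), the Galois group has a unique involution and is cyclic or generalised
quaternion.

* `zpow_mul_eq_mul_zpow_inv_of_conj_eq_inv`, `relations_of_not_mem_zpowers` — the quaternion relations for ONE `x ∉ ⟨a⟩` give
  them for EVERY `x' ∉ ⟨a⟩` when `⟨a⟩` has index `2`.
* `isCyclic_or_exists_quaternion_relations` — THE INDUCTION: `|G| = 2^n`, at most one involution ⟹ `G` cyclic, or `n ≥ 3` and
  `G ∋ a` of order `2^(n-1)` with `x a x⁻¹ = a⁻¹`, `x² = a^(2^(n-2))` for all `x ∉ ⟨a⟩`.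
* `isCyclic_or_nonempty_mulEquiv_quaternionGroup` — **`|G| = 2^n` with at most one involution ⟹ `G` is cyclic, or `n ≥ 3` and
  `G ≃* QuaternionGroup (2^(n-2))`** (the generalised quaternion group of order `2^n`).

## References

* [Rotman1995] J. J. Rotman, *An Introduction to the Theory of Groups*, 4th ed., GTM 148, Springer 1995, Thm. 5.46.
-/

namespace Summit.HodgeConjecture.CorCM.GaloisModels.UniqueInvolution

variable {G : Type*} [Group G]

/-! ## §1 The relations for one element outside `⟨a⟩` give them for all -/

/-- If `x` inverts `a` then `aᵏ x = x a⁻ᵏ` for every integer `k`. [folklore] -/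
theorem zpow_mul_eq_mul_zpow_inv_of_conj_eq_inv {a x : G} (hxa : x * a * x⁻¹ = a⁻¹) (k : ℤ) :
    a ^ k * x = x * (a ^ k)⁻¹ := by
  have h0 : x⁻¹ * a * x = a⁻¹ := by
    have h' : x⁻¹ * a⁻¹ * x = a := by
      conv_lhs => rw [← hxa]
      group
    rw [show x⁻¹ * a * x = (x⁻¹ * a⁻¹ * x)⁻¹ by group, h']
  have h1 : x⁻¹ * a ^ k * x = (a ^ k)⁻¹ := by
    have := map_zpow (MulAut.conj x⁻¹) a k
    simp only [MulAut.conj_apply, inv_inv] at this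
    rw [this, h0, inv_zpow]
  calc a ^ k * x = x * (x⁻¹ * a ^ k * x) := by group
    _ = x * (a ^ k)⁻¹ := by rw [h1]

/-- **The relations for one `x ∉ ⟨a⟩` give them for all**: if `⟨a⟩` has index `2`, `x ∉ ⟨a⟩`, `x a x⁻¹ = a⁻¹`, `x² = aᵏ`, then
every `x' ∉ ⟨a⟩` satisfies `x' a x'⁻¹ = a⁻¹` and `x'² = aᵏ`. [cite: Rotman1995, Thm. 5.46] -/
theorem relations_of_not_mem_zpowers {a x x' : G} {k : ℕ} (hidx : (Subgroup.zpowers a).index = 2)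
    (hx : x ∉ Subgroup.zpowers a) (hxa : x * a * x⁻¹ = a⁻¹) (hxx : x * x = a ^ k)
    (hx' : x' ∉ Subgroup.zpowers a) : x' * a * x'⁻¹ = a⁻¹ ∧ x' * x' = a ^ k := by
  have hmem : x⁻¹ * x' ∈ Subgroup.zpowers a := by
    rw [Subgroup.mul_mem_iff_of_index_two hidx, Subgroup.inv_mem_iff]
    exact ⟨fun h => absurd h hx, fun h => absurd h hx'⟩
  obtain ⟨i, hi⟩ := Subgroup.mem_zpowers_iff.1 hmem
  have hx'eq : x' = x * a ^ i := by rw [hi, mul_inv_cancel_left]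
  refine ⟨?_, ?_⟩
  · rw [hx'eq, show x * a ^ i * a * (x * a ^ i)⁻¹ = x * a * x⁻¹ by group, hxa]
  · rw [hx'eq, show x * a ^ i * (x * a ^ i) = x * (a ^ i * x) * a ^ i by group,
      zpow_mul_eq_mul_zpow_inv_of_conj_eq_inv hxa, show x * (x * (a ^ i)⁻¹) * a ^ i = x * x by group, hxx]

/-! ## §2 The induction and the final statements -/

/-- **THE INDUCTION** [Rotman1995, Thm. 5.46, `p = 2`]: a finite group of order `2^n` with at most one involution is cyclic, or
`n ≥ 3` and it contains an element `a` of order `2^(n-1)` such that every `x ∉ ⟨a⟩` satisfies `x a x⁻¹ = a⁻¹` and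
`x² = a^(2^(n-2))` (the generalised quaternion relations). [cite: Rotman1995, Thm. 5.46] -/
theorem isCyclic_or_exists_quaternion_relations [Finite G] {n : ℕ} (hcard : Nat.card G = 2 ^ n)
    (huniq : ∀ s t : G, s * s = 1 → s ≠ 1 → t * t = 1 → t ≠ 1 → s = t) :
    IsCyclic G ∨ ∃ a : G, 3 ≤ n ∧ orderOf a = 2 ^ (n - 1) ∧
      ∀ x : G, x ∉ Subgroup.zpowers a → x * a * x⁻¹ = a⁻¹ ∧ x * x = a ^ (2 ^ (n - 2)) := by
  induction n using Nat.strong_induction_on generalizing G with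
  | _ n ih =>
  classical
  haveI : Fact (Nat.Prime 2) := ⟨Nat.prime_two⟩
  rcases Nat.lt_or_ge n 2 with hn2 | hn2
  · left
    interval_cases n
    · haveI : Subsingleton G := (Nat.card_eq_one_iff_unique.mp (by simpa using hcard)).1
      exact isCyclic_of_subsingleton
    · exact isCyclic_of_prime_card (p := 2) (by rw [hcard]; norm_num)
  -- the key step from an element of order `2^(n-1)`
  have key : ∀ a : G, orderOf a = 2 ^ (n - 1) → IsCyclic G ∨ ∃ a : G, 3 ≤ n ∧ orderOf a = 2 ^ (n - 1) ∧
      ∀ x : G, x ∉ Subgroup.zpowers a → x * a * x⁻¹ = a⁻¹ ∧ x * x = a ^ (2 ^ (n - 2)) := by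
    intro a ha
    have hcard' : Nat.card G = 2 ^ (n - 1 + 1) := by rw [hcard, show n - 1 + 1 = n by omega]
    rcases isCyclic_or_exists_relations_of_orderOf_eq_two_pow (by omega) hcard' ha huniq with h | ⟨hm2, x, hx, hxa, hxx⟩
    · exact Or.inl h
    · right
      have hidx : (Subgroup.zpowers a).index = 2 := by
        have h1 := (Subgroup.zpowers a).index_mul_card
        rw [Nat.card_zpowers, ha, hcard', pow_succ, mul_comm _ 2] at h1
        exact Nat.eq_of_mul_eq_mul_right (by positivity) h1
      rw [show n - 1 - 1 = n - 2 by omega] at hxx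
      exact ⟨a, by omega, ha, fun x' hx' => relations_of_not_mem_zpowers hidx hx hxa hxx hx'⟩
  -- a subgroup of index two, and the induction hypothesis for it
  obtain ⟨H, hHcard⟩ := Sylow.exists_subgroup_card_pow_prime (G := G) 2 (n := n - 1)
    (by rw [hcard]; exact pow_dvd_pow 2 (by omega))
  have hpos : 0 < 2 ^ (n - 1) := by positivity
  have hH : H.index = 2 := by
    have h1 := H.index_mul_card
    rw [hHcard, hcard, show 2 ^ n = 2 * 2 ^ (n - 1) by rw [← pow_succ', show n - 1 + 1 = n by omega]] at h1
    exact Nat.eq_of_mul_eq_mul_right hpos h1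
  rcases ih (n - 1) (by omega) hHcard (subsingleton_involution_subgroup huniq H) with hcyc | ⟨a', hn3, ha', hrel'⟩
  · -- `H` cyclic
    obtain ⟨g, hg⟩ := hcyc.exists_ofOrder_eq_natCard
    exact key g (by rw [Subgroup.orderOf_coe, hg, hHcard])
  · -- `H` of quaternion type, with cyclic part generated by `a = ↑a'` of order `2^(n-2)`
    set a : G := (a' : G) with hadef
    have haH : a ∈ H := a'.2
    have ha : orderOf a = 2 ^ (n - 2) := by rw [hadef, Subgroup.orderOf_coe, ha', show n - 1 - 1 = n - 2 by omega]
    have hrel : ∀ h ∈ H, h ∉ Subgroup.zpowers a →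
        h * a * h⁻¹ = a⁻¹ ∧ h * h = a ^ (2 ^ (n - 2 - 1)) := by
      intro h hh hhA
      have hmem : (⟨h, hh⟩ : H) ∉ Subgroup.zpowers a' := fun hm => hhA ((mem_zpowers_coe_iff a' _).1 hm)
      obtain ⟨h1, h2⟩ := hrel' ⟨h, hh⟩ hmem
      refine ⟨?_, ?_⟩
      · have := congrArg Subtype.val h1
        simpa using this
      · have := congrArg Subtype.val h2
        simpa [show n - 1 - 2 = n - 2 - 1 by omega] using this
    rcases Nat.lt_or_ge n 5 with hn5 | hn5
    · -- `n = 4`: `H ≅ Q₈`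
      have hn4 : n = 4 := by omega
      subst hn4
      have ha4 : orderOf a = 4 := by rw [ha]; norm_num
      have hrel4 : ∀ h ∈ H, h ∉ Subgroup.zpowers a → h * a * h⁻¹ = a⁻¹ ∧ h * h = a ^ 2 := by
        simpa using hrel
      rcases exists_orderOf_eq_of_quaternion_subgroup_two (by rw [hcard]; norm_num) hH haH ha4 hrel4 huniq with h | ⟨g, hg⟩
      · exact Or.inl h
      · exact key g (by rw [hg]; norm_num)
    · have hcard' : Nat.card G = 2 ^ (n - 2 + 2) := by rw [hcard, show n - 2 + 2 = n by omega]
      rcases exists_orderOf_eq_of_quaternion_subgroup (m := n - 2) (by omega) hcard' hH haH ha hrel huniq with h | ⟨g, hg⟩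
      · exact Or.inl h
      · exact key g (by rw [hg, show n - 2 + 1 = n - 1 by omega])

/-- **A FINITE `2`-GROUP WITH AT MOST ONE INVOLUTION IS CYCLIC OR GENERALISED QUATERNION**: if `|G| = 2^n` and any two
involutions of `G` coincide, then `G` is cyclic, or `n ≥ 3` and `G ≃* QuaternionGroup (2^(n-2))` (Mathlib's dicyclic group of
order `4·2^(n-2) = 2^n`, i.e. the generalised quaternion group `Q_{2^n}`). [cite: Rotman1995, Thm. 5.46] -/
theorem isCyclic_or_nonempty_mulEquiv_quaternionGroup [Finite G] {n : ℕ} (hcard : Nat.card G = 2 ^ n)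
    (huniq : ∀ s t : G, s * s = 1 → s ≠ 1 → t * t = 1 → t ≠ 1 → s = t) :
    IsCyclic G ∨ (3 ≤ n ∧ Nonempty (G ≃* QuaternionGroup (2 ^ (n - 2)))) := by
  rcases isCyclic_or_exists_quaternion_relations hcard huniq with h | ⟨a, hn3, ha, hrel⟩
  · exact Or.inl h
  · refine Or.inr ⟨hn3, ?_⟩
    obtain ⟨x, hx⟩ : ∃ x : G, x ∉ Subgroup.zpowers a := by
      by_contra h
      push Not at h
      have htop : Subgroup.zpowers a = ⊤ := (Subgroup.eq_top_iff' _).2 h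
      have h1 : Nat.card (Subgroup.zpowers a) = Nat.card G := by rw [htop, Subgroup.card_top]
      rw [Nat.card_zpowers, ha, hcard] at h1
      have : 2 ^ (n - 1) < 2 ^ n := Nat.pow_lt_pow_right (by norm_num) (by omega)
      omega
    obtain ⟨hxa, hxx⟩ := hrel x hx
    haveI : NeZero (2 ^ (n - 2)) := ⟨by positivity⟩
    refine nonempty_mulEquiv_quaternionGroup_of_relations ?_ ?_ hx hxa hxx
    · rw [hcard, show n = n - 2 + 2 from by omega]
      simp only [Nat.add_sub_cancel]
      ring
    · rw [ha, show n - 1 = n - 2 + 1 by omega, pow_succ, mul_comm]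

end Summit.HodgeConjecture.CorCM.GaloisModels.UniqueInvolution
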